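import Summits.CriticalPhenomena.SAWScalingLimit.Theorems.SAWDevelopingMapObservableToSLECanonicalTransferCanonicalBound
import Summits.CriticalPhenomena.SAWScalingLimit.Theorems.SAWDevelopingMapObservableToSLECanonicalTransferInsensitivityB
import Summits.CriticalPhenomena.SAWScalingLimit.Theorems.SAWDevelopingMapObservableToSLECanonicalTransferHalfDisc
import HarnessLib

/-!
# Crux `SAWDevelopingMap.ObservableToSLE` (stmt-CriticalPhenomena-10472), line
`floor-ratio-restriction-bootstrap`, stub `stub_canonicalTransfer`: (CI) CANONICAL INSENSITIVITY
FROM HULL APPROXIMATION in the half-disc floor super-domain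

Landing target:
`Summits/CriticalPhenomena/SAWScalingLimit/Theorems/SAWDevelopingMapObservableToSLECanonicalTransferCanonicalInsensitivity.lean`
(`--supports stmt-CriticalPhenomena-10472`).  Sequel of `…CanonicalTransferCanonicalBound.lean`,
`…CanonicalTransferInsensitivityB.lean`, `…CanonicalTransferHalfDisc.lean`.

* `exists_halfDisc_superDomain` (= registered sub-goal `stub_canonicalTransfer_superDomain`) — a
  floor domain is a hull subdomain of a half-disc on its floor line with the same marked points,
  containing it with margin `1` and flat on the same floor balls;
* `canonicalInsensitivity_of_hullApprox` — **(M2'a) = (CI) from the admissible restriction limit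
  and (HA)**: the cocycle in the half-disc for the floor-friendly inner families of `D` and of the
  outer approximants `D'' ⊇ D` of (HA), the margin/closure property `Λ δ ⊆ L δ`, the fixed-scale
  bound `Z_Λ ≤ P^{can}(γ ⊆ Λ ∪ {a,b}) Z_L` and the ratio squeeze.
-/

noncomputable section

open scoped Topology NNReal ENNReal
open Filter Set Metric MeasureTheory
open Literature.Probability.LatticeModels (HexVertex hexGraph hexCenter Site)
open Literature.Probability.RandomPlanarGeometry
open Literature.Probability.RandomPlanarGeometry.SAW
open Literature.Probability.Percolation (PathIn)
open UpperHalfPlane (upperHalfPlaneSet)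
open Summit.CriticalPhenomena.SAWScalingLimit.Theorems.ObservableToSLE.Negative
  (finite_hexDomainSAW eventually_isProbabilityMeasure_hexSAWLaw)

namespace Summit.CriticalPhenomena.SAWScalingLimit.Theorems.ObservableToSLE.FloorRatio

/-- **The half-disc floor super-domain of a floor domain.**  A floor domain `D` (above the line
`Im = h` through its marked points, flat on `B(pt i, 16ρ')`) is a hull subdomain of a half-disc
`HD` on that line with the same marked points, containing `D` with margin `1` and flat on the same
floor balls. [folklore] -/
theorem exists_halfDisc_superDomain (D : DobrushinDomain) {ρ' : ℝ} (hρ'0 : 0 < ρ')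
    (hpt : (D.pt 1).im = (D.pt 0).im) (hDh : D.carrier ⊆ {z : ℂ | (D.pt 0).im < z.im})
    (hflD0 : {z : ℂ | (D.pt 0).im < z.im} ∩ ball (D.pt 0) (16 * ρ') ⊆ D.carrier)
    (hflD1 : {z : ℂ | (D.pt 0).im < z.im} ∩ ball (D.pt 1) (16 * ρ') ⊆ D.carrier) :
    ∃ (HD : DobrushinDomain) (c : ℂ) (R : ℝ),
      HD.carrier = {z : ℂ | (D.pt 0).im < z.im} ∩ ball c R ∧ HD.pt 0 = D.pt 0 ∧ HD.pt 1 = D.pt 1 ∧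
      (∀ z ∈ D.carrier, dist z c < R - 1) ∧
      {z : ℂ | (D.pt 0).im < z.im} ∩ ball (D.pt 0) (16 * ρ') ⊆ HD.carrier ∧
      {z : ℂ | (D.pt 0).im < z.im} ∩ ball (D.pt 1) (16 * ρ') ⊆ HD.carrier ∧
      HD.IsHullSubdomain D := by
  have hpt_ne : D.pt 0 ≠ D.pt 1 := D.pt_injective.ne (by decide)
  have hre : (D.pt 0).re ≠ (D.pt 1).re := by
    intro h
    exact hpt_ne (Complex.ext h hpt.symm)
  set c : ℂ := ⟨((D.pt 0).re + (D.pt 1).re) / 2, (D.pt 0).im⟩ with hc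
  obtain ⟨R₀, hR₀⟩ := D.isBounded.subset_ball c
  set R : ℝ := max R₀ 0 + |(D.pt 0).re - (D.pt 1).re| + 16 * ρ' + 2 with hR
  have hRabs : |(D.pt 0).re - (D.pt 1).re| < R := by
    rw [hR]; linarith [le_max_right R₀ 0, hρ'0]
  have hDball : ∀ z ∈ D.carrier, dist z c < R - 1 := fun z hz => by
    have := mem_ball.1 (hR₀ hz)
    rw [hR]
    linarith [le_max_left R₀ 0, abs_nonneg ((D.pt 0).re - (D.pt 1).re), hρ'0]
  have hdist_pt : ∀ i : Fin 2, dist (D.pt i) c ≤ |(D.pt 0).re - (D.pt 1).re| := by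
    intro i
    have key : ∀ p : ℂ, p.im = (D.pt 0).im → (p = D.pt 0 ∨ p = D.pt 1) →
        dist p c ≤ |(D.pt 0).re - (D.pt 1).re| := by
      intro p hpim hp
      rw [dist_eq_norm, Complex.norm_eq_sqrt_sq_add_sq]
      have h2 : (p - c).im = 0 := by simp [hc, hpim]
      rw [h2]
      simp only [ne_eq, OfNat.ofNat_ne_zero, not_false_eq_true, zero_pow, add_zero, Real.sqrt_sq_eq_abs]
      rcases hp with rfl | rfl
      · simp only [Complex.sub_re, hc]
        rw [show (D.pt 0).re - ((D.pt 0).re + (D.pt 1).re) / 2 = ((D.pt 0).re - (D.pt 1).re) / 2 by ring,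
          abs_div, abs_two]
        linarith [abs_nonneg ((D.pt 0).re - (D.pt 1).re)]
      · simp only [Complex.sub_re, hc]
        rw [show (D.pt 1).re - ((D.pt 0).re + (D.pt 1).re) / 2 = -(((D.pt 0).re - (D.pt 1).re) / 2) by ring,
          abs_neg, abs_div, abs_two]
        linarith [abs_nonneg ((D.pt 0).re - (D.pt 1).re)]
    fin_cases i
    · exact key _ rfl (Or.inl rfl)
    · exact key _ hpt (Or.inr rfl)
  have hballR : ∀ i : Fin 2, ball (D.pt i) (16 * ρ') ⊆ ball c R := fun i z hz => by
    rw [mem_ball] at hz ⊢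
    calc dist z c ≤ dist z (D.pt i) + dist (D.pt i) c := dist_triangle _ _ _
      _ < 16 * ρ' + |(D.pt 0).re - (D.pt 1).re| := add_lt_add_of_lt_of_le hz (hdist_pt i)
      _ ≤ R := by rw [hR]; linarith [le_max_right R₀ 0]
  obtain ⟨HD, hHDc, hHD0, hHD1⟩ := exists_halfDisc_dobrushinDomain (rfl : (D.pt 0).im = (D.pt 0).im)
    hpt hre hRabs
  have hDHD : D.carrier ⊆ HD.carrier := fun z hz => by
    rw [hHDc]; exact ⟨hDh hz, mem_ball.2 ((hDball z hz).trans (by linarith))⟩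
  have hHDh : HD.carrier ⊆ {z : ℂ | (D.pt 0).im < z.im} := by rw [hHDc]; exact inter_subset_left
  have hflHD0 : {z : ℂ | (D.pt 0).im < z.im} ∩ ball (D.pt 0) (16 * ρ') ⊆ HD.carrier := fun z hz => by
    rw [hHDc]; exact ⟨hz.1, hballR 0 hz.2⟩
  have hflHD1 : {z : ℂ | (D.pt 0).im < z.im} ∩ ball (D.pt 1) (16 * ρ') ⊆ HD.carrier := fun z hz => by
    rw [hHDc]; exact ⟨hz.1, hballR 1 hz.2⟩
  refine ⟨HD, c, R, hHDc, hHD0, hHD1, hDball, hflHD0, hflHD1,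
    isHullSubdomain_of_flat (ρ := 16 * ρ') (by positivity) hDHD hHD0.symm hHD1.symm
      (fun z hz => hflD0 ⟨hHDh hz.1, by rw [← hHD0]; exact hz.2⟩)
      (fun z hz => hflD1 ⟨hHDh hz.1, by rw [← hHD1]; exact hz.2⟩)⟩

/-- **(CI) CANONICAL INSENSITIVITY FROM HULL APPROXIMATION.**  Under the admissible restriction limit
and (HA), for every floor domain `D` with canonical floor endpoints and its floor-friendly inner
family `Λ` (component of the bulk vertex in the deep vertices, exact floor rows, exhausting the
compacts, without bad edges) the canonical critical SAW stays inside `Λ δ ∪ {a δ, b δ}` with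
probability `→ 1`.  Mechanism: `D` is a hull subdomain of the half-disc `HD` on its floor line
through far-away points (`exists_halfDisc_dobrushinDomain`, `isHullSubdomain_of_flat`); by the
margin property every point of `D` of row `≥ m` is deep in the outer approximant `D'' ⊇ D` of (HA)
(inside `HD`), so `Λ δ ⊆ L δ` (the inner family of `D''`) and `L δ` is closed under honeycomb steps
to such points; hence ALL canonical walks are walks in `L δ` and
`P^{can}(γ ⊆ Λ δ ∪ {a, b}) ≥ Z_{Λδ}/Z_{Lδ}` (`sum_le_measure_inside_mul_sum`), while the cocycle in
`HD` for the pairs `(W, Λ)`, `(W, L)` (`W` the inner family of `HD`) gives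
`Z_{Λδ}/Z_{Lδ} → (Φ'_A(0)/Φ'_{A''}(0))^{5/8} ≥ 1/(1 + ε)`. [cite: LawlerSchrammWerner2004SAW, §3.4 ("SAW satisfies restriction")] -/
theorem canonicalInsensitivity_of_hullApprox :
    (∀ (D D' : DobrushinDomain) (ρ : ℝ) (φ : ConformalEquiv upperHalfPlaneSet D.carrier)
    (Φ : ConformalEquiv (upperHalfPlaneSet \ φ.pullbackHull D') upperHalfPlaneSet) (d : ℝ)
    (Λ Λ' : ℝ → Finset HexVertex) (m : ℝ → ℤ) (a b : ℝ → Sym2 HexVertex),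
    (0 < ρ ∧ (D.pt 1).im = (D.pt 0).im ∧ D.carrier ⊆ {z : ℂ | (D.pt 0).im < z.im} ∧
    D.carrier ∩ ball (D.pt 0) ρ = {z : ℂ | (D.pt 0).im < z.im} ∩ ball (D.pt 0) ρ ∧
    D.carrier ∩ ball (D.pt 1) ρ = {z : ℂ | (D.pt 1).im < z.im} ∩ ball (D.pt 1) ρ) → D.IsHullSubdomain D' → D.IsChordalUniformizing φ →
    IsRestrictionMap (φ.pullbackHull D') Φ → HasRestrictionDeriv (φ.pullbackHull D') Φ d →
    (∀ᶠ δ : ℝ in 𝓝[>] 0,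
    Λ' δ ⊆ Λ δ ∧ hexDomainSimplyConnected (Λ δ) ∧ hexDomainSimplyConnected (Λ' δ) ∧
    (hexGraph.induce (↑(Λ δ) : Set HexVertex)).Preconnected ∧
    (hexGraph.induce (↑(Λ' δ) : Set HexVertex)).Preconnected ∧
    a δ ∈ hexDomainBoundary (Λ δ) ∧ b δ ∈ hexDomainBoundary (Λ δ) ∧
    a δ ∈ hexDomainBoundary (Λ' δ) ∧ b δ ∈ hexDomainBoundary (Λ' δ) ∧
    Nonempty (HexMidEdgeSAW (Λ' δ) (a δ) (b δ)) ∧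
    (∀ v ∈ Λ δ, (δ : ℂ) * hexCenter v ∈ D.carrier ∧ m δ ≤ v.1 1) ∧
    (∀ v ∈ Λ' δ, (δ : ℂ) * hexCenter v ∈ D'.carrier) ∧
    (∀ v : HexVertex, (δ : ℂ) * hexCenter v ∈ ball (D.pt 0) ρ ∪ ball (D.pt 1) ρ →
    ((v ∈ Λ δ ↔ m δ ≤ v.1 1) ∧ (v ∈ Λ' δ ↔ m δ ≤ v.1 1)))) →
    (∀ K : Set ℂ, IsCompact K → K ⊆ D.carrier →
    ∀ᶠ δ : ℝ in 𝓝[>] 0, ∀ v : HexVertex, (δ : ℂ) * hexCenter v ∈ K → v ∈ Λ δ) →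
    (∀ K : Set ℂ, IsCompact K → K ⊆ D'.carrier →
    ∀ᶠ δ : ℝ in 𝓝[>] 0, ∀ v : HexVertex, (δ : ℂ) * hexCenter v ∈ K → v ∈ Λ' δ) →
    Tendsto (fun δ : ℝ => (δ : ℂ) * hexMidpoint (a δ)) (𝓝[>] 0) (𝓝 (D.pt 0)) →
    Tendsto (fun δ : ℝ => (δ : ℂ) * hexMidpoint (b δ)) (𝓝[>] 0) (𝓝 (D.pt 1)) →
    Tendsto (fun δ : ℝ => (∑ γ : HexMidEdgeSAW (Λ' δ) (a δ) (b δ), hexCriticalFugacity ^ γ.length) /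
    (∑ γ : HexMidEdgeSAW (Λ δ) (a δ) (b δ), hexCriticalFugacity ^ γ.length)) (𝓝[>] 0)
    (𝓝 (d ^ ((5 : ℝ) / 8)))) →
    (∀ (D D' : DobrushinDomain), D.IsHullSubdomain D' →
      ∀ (φ : ConformalEquiv upperHalfPlaneSet D.carrier)
      (Φ : ConformalEquiv (upperHalfPlaneSet \ φ.pullbackHull D') upperHalfPlaneSet) (d : ℝ),
      D.IsChordalUniformizing φ → IsRestrictionMap (φ.pullbackHull D') Φ →
      HasRestrictionDeriv (φ.pullbackHull D') Φ d →
      ∀ ε : ℝ, 0 < ε → ∃ (D'' : DobrushinDomain)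
        (Φ'' : ConformalEquiv (upperHalfPlaneSet \ φ.pullbackHull D'') upperHalfPlaneSet) (d'' η : ℝ),
        D.IsHullSubdomain D'' ∧ D'.carrier ⊆ D''.carrier ∧ 0 < η ∧
        (∀ z ∈ D.carrier, Metric.infDist z D'.carrier ≤ η → z ∈ D''.carrier) ∧
        IsRestrictionMap (φ.pullbackHull D'') Φ'' ∧ HasRestrictionDeriv (φ.pullbackHull D'') Φ'' d'' ∧
        d'' ^ ((5 : ℝ) / 8) ≤ (1 + ε) * d ^ ((5 : ℝ) / 8)) →
    ∀ (D : DobrushinDomain) (ρ ρ' : ℝ) (a b : ℝ → HexVertex) (Λ : ℝ → Finset HexVertex)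
      (m : ℝ → ℤ) (v₀ : ℝ → HexVertex),
      (0 < ρ ∧ (D.pt 1).im = (D.pt 0).im ∧ D.carrier ⊆ {z : ℂ | (D.pt 0).im < z.im} ∧
      D.carrier ∩ ball (D.pt 0) ρ = {z : ℂ | (D.pt 0).im < z.im} ∩ ball (D.pt 0) ρ ∧
      D.carrier ∩ ball (D.pt 1) ρ = {z : ℂ | (D.pt 1).im < z.im} ∩ ball (D.pt 1) ρ) →
      (IsEmbEndpointApprox hexGraph hexCenter D a b ∧ ∀ᶠ δ : ℝ in 𝓝[>] 0,
      (∃ u : HexVertex, hexGraph.Adj (a δ) u ∧ ((δ : ℂ) * hexCenter u).im ≤ (D.pt 0).im) ∧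
      (∃ u : HexVertex, hexGraph.Adj (b δ) u ∧ ((δ : ℂ) * hexCenter u).im ≤ (D.pt 1).im)) →
      0 < ρ' →
      (∀ δ : ℝ, 0 < δ → ((m δ : ℝ) - 2 / 3) * (δ * (Real.sqrt 3 / 2)) ≤ (D.pt 0).im ∧
        (D.pt 0).im < ((m δ : ℝ) + 1 / 3) * (δ * (Real.sqrt 3 / 2))) →
      ({z : ℂ | (D.pt 0).im < z.im} ∩ ball (D.pt 0) (16 * ρ') ⊆ D.carrier) →
      ({z : ℂ | (D.pt 0).im < z.im} ∩ ball (D.pt 1) (16 * ρ') ⊆ D.carrier) →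
      (∀ δ : ℝ, 0 < δ →
        dist ((δ : ℂ) * hexCenter (v₀ δ)) (D.pt 0 + ((4 * ρ' : ℝ) : ℂ) * Complex.I) ≤ δ) →
      (∀ᶠ δ : ℝ in 𝓝[>] 0, hexDomainSimplyConnected (Λ δ) ∧
        (hexGraph.induce (↑(Λ δ) : Set HexVertex)).Preconnected ∧
        ∀ z : HexVertex, z ∈ Λ δ ↔ PathIn hexGraph
        {u : HexVertex | (δ : ℂ) * hexCenter u ∈ D.carrier ∧ m δ ≤ u.1 1 ∧
          closedBall ((δ : ℂ) * hexCenter u) (25 * δ) ∩ {z : ℂ | (D.pt 0).im < z.im} ⊆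
            D.carrier ∪ ball (D.pt 0) (12 * ρ') ∪ ball (D.pt 1) (12 * ρ')} (v₀ δ) z) →
      (∀ᶠ δ : ℝ in 𝓝[>] 0, ∀ v : HexVertex,
        (δ : ℂ) * hexCenter v ∈ ball (D.pt 0) ρ' ∪ ball (D.pt 1) ρ' → m δ ≤ v.1 1 → v ∈ Λ δ) →
      (∀ K : Set ℂ, IsCompact K → K ⊆ D.carrier →
        ∀ᶠ δ : ℝ in 𝓝[>] 0, ∀ v : HexVertex, (δ : ℂ) * hexCenter v ∈ K → v ∈ Λ δ) →
      (∀ᶠ δ : ℝ in 𝓝[>] 0, ∀ v ∈ Λ δ, ∀ w ∈ Λ δ, hexGraph.Adj v w →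
        (hexDomainGraph D.carrier δ).Adj v w) →
      Tendsto (fun δ : ℝ => ((hexSAWLaw D.carrier δ (a δ) (b δ))
        {γ | ∀ v ∈ γ.walk.support, v ∈ Λ δ ∨ v = a δ ∨ v = b δ}).toReal) (𝓝[>] 0) (𝓝 1) := by
  intro H HA D ρ ρ' a b Λ m v₀ hfl hend hρ'0 hm hflD0 hflD1 hv₀ hΛall hrows hK hbad
  obtain ⟨hρ0, hpt, hDh, hfl0, hfl1⟩ := hfl
  obtain ⟨hab, hend'⟩ := hend
  -- the half-disc super-domain
  have hpt_ne : D.pt 0 ≠ D.pt 1 := D.pt_injective.ne (by decide)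
  obtain ⟨HD, c, R, hHDc, hHD0, hHD1, hDball, hflHD0, hflHD1, hHDD⟩ :=
    exists_halfDisc_superDomain D hρ'0 hpt hDh hflD0 hflD1
  have hDHD : D.carrier ⊆ HD.carrier := hHDD.carrier_subset
  have hHDh : HD.carrier ⊆ {z : ℂ | (D.pt 0).im < z.im} := by rw [hHDc]; exact inter_subset_left
  have hflHDρ : 0 < ρ' ∧ (HD.pt 1).im = (HD.pt 0).im ∧ HD.carrier ⊆ {z : ℂ | (HD.pt 0).im < z.im} ∧
      HD.carrier ∩ ball (HD.pt 0) ρ' = {z : ℂ | (HD.pt 0).im < z.im} ∩ ball (HD.pt 0) ρ' ∧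
      HD.carrier ∩ ball (HD.pt 1) ρ' = {z : ℂ | (HD.pt 1).im < z.im} ∩ ball (HD.pt 1) ρ' := by
    rw [hHD0, hHD1]
    refine ⟨hρ'0, hpt, hHDh, inter_ball_eq_of_flat hHDh fun z hz => hflHD0 ⟨hz.1, ?_⟩, ?_⟩
    · exact ball_subset_ball (by linarith) hz.2
    · rw [hpt]
      exact inter_ball_eq_of_flat hHDh fun z hz => hflHD1 ⟨hz.1, ball_subset_ball (by linarith) hz.2⟩
  have hEHD := HD.toJordanDomain.isConnected_compl_closure
    Literature.Topology.PlaneTopology.JordanCurveTheorem_holds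
  have hv₀' : ∀ δ : ℝ, 0 < δ →
      dist ((δ : ℂ) * hexCenter (v₀ δ)) (D.pt 0 + ((16 * ρ' / 4 : ℝ) : ℂ) * Complex.I) ≤ δ := by
    intro δ hδ
    rw [show 16 * ρ' / 4 = 4 * ρ' by ring]
    exact hv₀ δ hδ
  have e12 : 3 * (16 * ρ') / 4 = 12 * ρ' := by ring
  have e1 : 16 * ρ' / 16 = ρ' := by ring
  -- the inner family of the half-disc
  obtain ⟨W, hWall, hWK, hWrows⟩ := exists_innerFamily HD.isOpen HD.isConnected HD.isBounded hHDh
    hEHD.1 hEHD.2 rfl hpt (by positivity : (0 : ℝ) < 16 * ρ') hflHD0 hflHD1 hm hv₀'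
  rw [e12] at hWall
  rw [e1] at hWrows
  -- endpoint data
  set σa : ℝ → Sym2 HexVertex := fun δ => s(a δ, if (a δ).2 = 0 then
    (((a δ).1 - Pi.single 1 1, 1) : HexVertex) else ((a δ).1 + Pi.single 1 1, 0)) with hσa
  set σb : ℝ → Sym2 HexVertex := fun δ => s(b δ, if (b δ).2 = 0 then
    (((b δ).1 - Pi.single 1 1, 1) : HexVertex) else ((b δ).1 + Pi.single 1 1, 0)) with hσb
  have hσa_t : Tendsto (fun δ : ℝ => (δ : ℂ) * hexMidpoint (σa δ)) (𝓝[>] 0) (𝓝 (D.pt 0)) :=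
    tendsto_smul_hexMidpoint hab.tendsto_fst (Eventually.of_forall fun δ =>
      hexGraph_adj_floorNeighbour (a δ))
  have hσb_t : Tendsto (fun δ : ℝ => (δ : ℂ) * hexMidpoint (σb δ)) (𝓝[>] 0) (𝓝 (D.pt 1)) :=
    tendsto_smul_hexMidpoint hab.tendsto_snd (Eventually.of_forall fun δ =>
      hexGraph_adj_floorNeighbour (b δ))
  have haim := eventually_im_lt_of_endpointApprox hDh hab
  have hend'' : ∀ᶠ δ : ℝ in 𝓝[>] 0,
      (∃ u : HexVertex, hexGraph.Adj (a δ) u ∧ ((δ : ℂ) * hexCenter u).im ≤ (HD.pt 0).im) ∧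
      (∃ u : HexVertex, hexGraph.Adj (b δ) u ∧ ((δ : ℂ) * hexCenter u).im ≤ (HD.pt 1).im) := by
    rw [hHD0, hHD1]; exact hend'
  -- admissibility of `(W, Λ)` for `(HD, D)` and the cocycle
  have hADM : _ := pair_admissible (D := HD) (E := D.carrier) (σa := σa) (σb := σb)
    (by rw [hHD0, hHD1]; exact hpt) (by rw [hHD0]; exact hHDh) hρ'0 hDHD (by rw [hHD0]; exact hm)
    (by rw [hHD0]; exact hab.tendsto_fst) (by rw [hHD1]; exact hab.tendsto_snd) (by rw [hHD0]; exact haim)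
    hend'' (Eventually.of_forall fun _ => rfl) (Eventually.of_forall fun _ => rfl)
    (by rw [hHD0, hHD1]; exact hWall) (by rw [hHD0, hHD1]; exact hWrows.mono fun δ h v hv hvm => h v hvm hv)
    (by rw [hHD0, hHD1]; exact hΛall) (by rw [hHD0, hHD1]; exact hrows)
  obtain ⟨φ, hφ⟩ := MarkedDomain.exists_isChordalUniformizing_holds HD
  have hA : IsStarHull (φ.pullbackHull D) :=
    IsStarHull.pullbackHull JordanDomain.isSimplyConnected_holds hφ hHDD
  obtain ⟨Φ, hΦ, -⟩ := IsStarHull.existsUnique_isRestrictionMap_holds hA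
  obtain ⟨d, hd0, -, hd⟩ := IsStarHull.exists_hasRestrictionDeriv_holds hA hΦ
  have hd58 : 0 < d ^ ((5 : ℝ) / 8) := Real.rpow_pos_of_pos hd0 _
  have hσa_t' : Tendsto (fun δ : ℝ => (δ : ℂ) * hexMidpoint (σa δ)) (𝓝[>] 0) (𝓝 (HD.pt 0)) := by
    rw [hHD0]; exact hσa_t
  have hσb_t' : Tendsto (fun δ : ℝ => (δ : ℂ) * hexMidpoint (σb δ)) (𝓝[>] 0) (𝓝 (HD.pt 1)) := by
    rw [hHD1]; exact hσb_t
  have hT := H HD D ρ' φ Φ d W Λ m σa σb hflHDρ hHDD hφ hΦ hd hADM hWK hK hσa_t' hσb_t'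
  -- the squeeze
  have hballa := eventually_adj_mem_ball hρ'0 hab.tendsto_fst
  have hballb := eventually_adj_mem_ball hρ'0 hab.tendsto_snd
  have hne := eventually_ne_of_tendsto_nhds hpt_ne hab.tendsto_fst hab.tendsto_snd
  have hσne := eventually_ne_of_tendsto_nhds hpt_ne hσa_t hσb_t
  refine tendsto_one_of_ratio_squeeze_le
    ((eventually_isProbabilityMeasure_hexSAWLaw hab).mono fun δ hP => ?_) fun ε hε => ?_
  · exact ENNReal.toReal_le_of_le_ofReal zero_le_one (by rw [ENNReal.ofReal_one]; exact prob_le_one)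
  obtain ⟨D'', Φ'', d'', η, hD'', hDD'', hη, hmargin, hΦ'', hd'', hle⟩ := HA HD D hHDD φ Φ d hφ hΦ hd ε hε
  have hD''HD : D''.carrier ⊆ HD.carrier := hD''.carrier_subset
  have hD''h : D''.carrier ⊆ {z : ℂ | (D.pt 0).im < z.im} := hD''HD.trans hHDh
  have hE'' := D''.toJordanDomain.isConnected_compl_closure
    Literature.Topology.PlaneTopology.JordanCurveTheorem_holds
  obtain ⟨L, hLall, hLK, hLrows⟩ := exists_innerFamily D''.isOpen D''.isConnected D''.isBounded hD''h
    hE''.1 hE''.2 rfl hpt (by positivity : (0 : ℝ) < 16 * ρ') (hflD0.trans hDD'') (hflD1.trans hDD'') hm hv₀'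
  rw [e12] at hLall
  rw [e1] at hLrows
  have hADM'' : _ := pair_admissible (D := HD) (E := D''.carrier) (σa := σa) (σb := σb)
    (by rw [hHD0, hHD1]; exact hpt) (by rw [hHD0]; exact hHDh) hρ'0 hD''HD (by rw [hHD0]; exact hm)
    (by rw [hHD0]; exact hab.tendsto_fst) (by rw [hHD1]; exact hab.tendsto_snd) (by rw [hHD0]; exact haim)
    hend'' (Eventually.of_forall fun _ => rfl) (Eventually.of_forall fun _ => rfl)
    (by rw [hHD0, hHD1]; exact hWall) (by rw [hHD0, hHD1]; exact hWrows.mono fun δ h v hv hvm => h v hvm hv)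
    (by rw [hHD0, hHD1]; exact hLall) (by rw [hHD0, hHD1]; exact hLrows.mono fun δ h v hv hvm => h v hvm hv)
  have hA'' : IsStarHull (φ.pullbackHull D'') :=
    IsStarHull.pullbackHull JordanDomain.isSimplyConnected_holds hφ hD''
  have hd''0 : 0 < d'' := HasRestrictionDeriv.pos IsStarHull.exists_hasRestrictionDeriv_holds hA'' hΦ'' hd''
  have hd''58 : 0 < d'' ^ ((5 : ℝ) / 8) := Real.rpow_pos_of_pos hd''0 _
  have hT'' := H HD D'' ρ' φ Φ'' d'' W L m σa σb hflHDρ hD'' hφ hΦ'' hd'' hADM'' hWK hLK hσa_t' hσb_t'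
  refine ⟨fun δ => ((∑ γ : HexMidEdgeSAW (Λ δ) (σa δ) (σb δ), hexCriticalFugacity ^ γ.length) /
      (∑ γ : HexMidEdgeSAW (W δ) (σa δ) (σb δ), hexCriticalFugacity ^ γ.length)) /
      ((∑ γ : HexMidEdgeSAW (L δ) (σa δ) (σb δ), hexCriticalFugacity ^ γ.length) /
      (∑ γ : HexMidEdgeSAW (W δ) (σa δ) (σb δ), hexCriticalFugacity ^ γ.length)),
    d ^ ((5 : ℝ) / 8) / d'' ^ ((5 : ℝ) / 8), ?_, hT.div hT'' hd''58.ne', ?_⟩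
  · -- `1 - ε ≤ (d / d'')^{5/8}`
    rw [le_div_iff₀ hd''58]
    rcases le_or_gt ε 1 with hε1 | hε1
    · calc (1 - ε) * d'' ^ ((5 : ℝ) / 8) ≤ (1 - ε) * ((1 + ε) * d ^ ((5 : ℝ) / 8)) :=
            mul_le_mul_of_nonneg_left hle (by linarith)
        _ = (1 - ε ^ 2) * d ^ ((5 : ℝ) / 8) := by ring
        _ ≤ d ^ ((5 : ℝ) / 8) := by nlinarith [sq_nonneg ε, hd58]
    · have : (1 - ε) * d'' ^ ((5 : ℝ) / 8) ≤ 0 := mul_nonpos_of_nonpos_of_nonneg (by linarith) hd''58.le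
      linarith
  -- eventually `g ≤ P(In)`: the fixed-scale lower bound with `Λ δ ⊆ L δ`
  filter_upwards [Ioc_mem_nhdsGT (show (0 : ℝ) < min (η / 25) (1 / 25) by positivity), hADM, hADM'',
    hΛall, hLall, hrows, hbad, hend', haim, hab.reachable, hne, hσne, hballa, hballb]
    with δ hδ hA1 hA2 hΛc hLc hR hbadδ hE hIm hReach hab' hσ hBa hBb
  have hδη : 25 * δ ≤ η := by linarith [hδ.2.trans (min_le_left _ _)]
  have hδ1 : 25 * δ ≤ 1 := by linarith [hδ.2.trans (min_le_right _ _)]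
  obtain ⟨hΛW, -, -, -, -, -, -, -, -, hNΛ, -⟩ := hA1
  obtain ⟨hLW, -, -, -, -, -, -, -, -, hNL, -⟩ := hA2
  have hchar := hΛc.2.2
  have hcharL := hLc.2.2
  -- `Λ δ ⊆ L δ` and the closure property of `L δ`
  have hSS : {u : HexVertex | (δ : ℂ) * hexCenter u ∈ D.carrier ∧ m δ ≤ u.1 1 ∧
      closedBall ((δ : ℂ) * hexCenter u) (25 * δ) ∩ {z : ℂ | (D.pt 0).im < z.im} ⊆
        D.carrier ∪ ball (D.pt 0) (12 * ρ') ∪ ball (D.pt 1) (12 * ρ')} ⊆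
      {u : HexVertex | (δ : ℂ) * hexCenter u ∈ D''.carrier ∧ m δ ≤ u.1 1 ∧
      closedBall ((δ : ℂ) * hexCenter u) (25 * δ) ∩ {z : ℂ | (D.pt 0).im < z.im} ⊆
        D''.carrier ∪ ball (D.pt 0) (12 * ρ') ∪ ball (D.pt 1) (12 * ρ')} :=
    fun u ⟨h1, h2, h3⟩ => ⟨hDD'' h1, h2,
      h3.trans (union_subset_union_left _ (union_subset_union_left _ hDD''))⟩
  have hΛL : Λ δ ⊆ L δ := fun z hz => (hcharL z).2 (((hchar z).1 hz).mono hSS)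
  have hdeep : ∀ w : HexVertex, (δ : ℂ) * hexCenter w ∈ D.carrier → m δ ≤ w.1 1 →
      ((δ : ℂ) * hexCenter w ∈ D''.carrier ∧ m δ ≤ w.1 1 ∧
      closedBall ((δ : ℂ) * hexCenter w) (25 * δ) ∩ {z : ℂ | (D.pt 0).im < z.im} ⊆
        D''.carrier ∪ ball (D.pt 0) (12 * ρ') ∪ ball (D.pt 1) (12 * ρ')) := by
    intro w hwD hwm
    refine ⟨hDD'' hwD, hwm, fun y hy => Or.inl (Or.inl (hmargin y ?_ ?_))⟩
    · rw [hHDc]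
      refine ⟨hy.2, mem_ball.2 ?_⟩
      calc dist y c ≤ dist y ((δ : ℂ) * hexCenter w) + dist ((δ : ℂ) * hexCenter w) c := dist_triangle _ _ _
        _ < 25 * δ + (R - 1) := add_lt_add_of_le_of_lt (mem_closedBall.1 hy.1) (hDball _ hwD)
        _ ≤ R := by linarith
    · calc Metric.infDist y D.carrier ≤ dist y ((δ : ℂ) * hexCenter w) :=
            Metric.infDist_le_dist_of_mem hwD
        _ ≤ 25 * δ := mem_closedBall.1 hy.1
        _ ≤ η := hδη
  have hcl : ∀ v ∈ L δ, ∀ w : HexVertex, (δ : ℂ) * hexCenter w ∈ D.carrier → m δ ≤ w.1 1 →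
      hexGraph.Adj v w → w ∈ L δ := fun v hv w hwD hwm hadj =>
    (hcharL w).2 (((hcharL v).1 hv).tail hadj (hdeep w hwD hwm))
  have hLh : ∀ v ∈ L δ, (D.pt 0).im < ((δ : ℂ) * hexCenter v).im := fun v hv =>
    hD''h ((hcharL v).1 hv).right_mem.1
  have hLrow : ∀ v ∈ L δ, m δ ≤ v.1 1 := fun v hv => ((hcharL v).1 hv).right_mem.2.1
  obtain ⟨⟨ua, hua, huaim⟩, ⟨ub, hub, hubim⟩⟩ := hE
  rw [hpt] at hubim
  have hab'' : a δ ≠ b δ := fun h => hab' (by rw [h])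
  obtain ⟨wa, hwa⟩ := exists_adj_of_reachable hReach hab''
  obtain ⟨wb, hwb⟩ := exists_adj_of_reachable hReach.symm hab''.symm
  haveI : Fintype (HexDomainSAW D.carrier δ (a δ) (b δ)) :=
    @Fintype.ofFinite _ (finite_hexDomainSAW D.isBounded hδ.1.ne' _ _)
  have hσne' : s(a δ, if (a δ).2 = 0 then (((a δ).1 - Pi.single 1 1, 1) : HexVertex)
      else ((a δ).1 + Pi.single 1 1, 0)) ≠ s(b δ, if (b δ).2 = 0 then
      (((b δ).1 - Pi.single 1 1, 1) : HexVertex) else ((b δ).1 + Pi.single 1 1, 0)) := fun h => hσ (by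
    show (δ : ℂ) * hexMidpoint (σa δ) = (δ : ℂ) * hexMidpoint (σb δ)
    simp only [hσa, hσb]; rw [h])
  have key := sum_le_measure_inside_mul_sum (Λ := Λ δ) (L := L δ) hδ.1 hDh (hm δ hδ.1).1 (hm δ hδ.1).2
    hbadδ hΛL hcl hLh hLrow hR hBa hBb hua huaim hub hubim hIm.1 hIm.2 hwa hwb hab'' hσne'
  -- unfold the ratio
  have hΛpos : 0 < ∑ γ : HexMidEdgeSAW (Λ δ) (σa δ) (σb δ), hexCriticalFugacity ^ γ.length :=
    sum_pow_length_pos hNΛ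
  have hLpos : 0 < ∑ γ : HexMidEdgeSAW (L δ) (σa δ) (σb δ), hexCriticalFugacity ^ γ.length :=
    sum_pow_length_pos hNL
  have hWpos : 0 < ∑ γ : HexMidEdgeSAW (W δ) (σa δ) (σb δ), hexCriticalFugacity ^ γ.length :=
    hΛpos.trans_le (sum_pow_length_mono hΛW)
  rw [div_div_div_cancel_right₀ hWpos.ne', div_le_iff₀ hLpos]
  exact key

/-- **Registered sub-goal `stub_canonicalTransfer_superDomain`** (crux item stmt-CriticalPhenomena-10472,
stub `stub_canonicalTransfer`): the half-disc floor super-domain, registry form of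
`exists_halfDisc_superDomain`. [folklore] -/
theorem stub_canonicalTransfer_superDomain :
    ∀ (D : DobrushinDomain) (ρ' : ℝ), 0 < ρ' → (D.pt 1).im = (D.pt 0).im →
    D.carrier ⊆ {z : ℂ | (D.pt 0).im < z.im} →
    {z : ℂ | (D.pt 0).im < z.im} ∩ ball (D.pt 0) (16 * ρ') ⊆ D.carrier →
    {z : ℂ | (D.pt 0).im < z.im} ∩ ball (D.pt 1) (16 * ρ') ⊆ D.carrier →
    ∃ (HD : DobrushinDomain) (c : ℂ) (R : ℝ),
      HD.carrier = {z : ℂ | (D.pt 0).im < z.im} ∩ ball c R ∧ HD.pt 0 = D.pt 0 ∧ HD.pt 1 = D.pt 1 ∧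
      (∀ z ∈ D.carrier, dist z c < R - 1) ∧
      {z : ℂ | (D.pt 0).im < z.im} ∩ ball (D.pt 0) (16 * ρ') ⊆ HD.carrier ∧
      {z : ℂ | (D.pt 0).im < z.im} ∩ ball (D.pt 1) (16 * ρ') ⊆ HD.carrier ∧
      HD.IsHullSubdomain D :=
  fun D _ hρ'0 hpt hDh hflD0 hflD1 => exists_halfDisc_superDomain D hρ'0 hpt hDh hflD0 hflD1

end Summit.CriticalPhenomena.SAWScalingLimit.Theorems.ObservableToSLE.FloorRatio

end
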